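import Summits.ResolutionOfSingularities.ResolutionOfSingularities.Theorems.OddCrossCutCells
import Summits.ResolutionOfSingularities.ResolutionOfSingularities.Theorems.MaxContactCutDeepCrossCut
import HarnessLib

/-!
# MaxContactCutOddCrossCut — the decomp-res node «OddCrossCut» BY NAME on the host route `MaxContactCut` (lens-2
g23, pin aae59dc8)

Content VERBATIM from the decomp-res lens-2 g23 node `HOME/decomp-res-lens-2/g23/OddCrossCut.lean` (pin aae59dc8, 6
388 l; HOME = run/shared/lean/pub/decomp-res); CRITIC-LEDGER row 184 CLEARED ((X***) `OddCrossExit`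
DECIDED-MOD-PORT(M+) +1 · MAP 0: residue-characteristic ≠ 2 deep crosses typed as a CLASS WITH TAILS + the odd
guard; exit package decided on paper to cn27 standard by ODD DOMINATION; exact re-location of `IsDeepSpecialPt`);
landing orders NEXT-g24 §Landing + critic rider INBOX :970: ONLY the NEW part §Z (node lines 5511–6388) is landed —
the node's CARRIED copies of g14–g22 (lines 306–4942, 4991–5507; ns `…Theses.OddCrossCut`) are NOT landed
(DELETE-on-landing: they ARE the tree modules
PinchCut/JetCut/PurityCut/SplitCut/CylinderCut/SpreadCut/CrossCut/DeepCrossCut*, opened here instead); namespace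
`…Theses.OddCrossCut` ↦ `…Theorems.OddCrossCut`; all files `--kind proof --supports
stmt-ResolutionOfSingularities-29273` (the ring-kernel file as helper).  Farm (node, critic re-farm): rc 0 · 0 err ·
0 warn · 0 sorry · axioms std.

THE WIRING of the node VERBATIM, BY NAME on the host route `MaxContactCut` (in the Theses cone), in lens order:
`OddX.rungOne_iff : MaxContactCut.RungOne ⟺ OddGenericRung ∧ OddSpecialRung`, **`OddX.closes`**,
`isExitPt_of_oddLeaf`, `oddGenRungAt_of_engines`, `oddGenericRung_of_engines/_of_ports`, `closes_of_engines`, and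
the §Z.7 EXACT re-locations incl. **`leafSpecialRung_iff_oddSpecialRung`** (tree aside 33866 ⟺ the odd residual
modulo the odd decided half) and `deep_closes_of_odd`; imports `OddCrossCutCells` + `MaxContactCutDeepCrossCut`; 0 sorry.

This file carries: `OddX.rungOne_iff`, `OddX.oddGenericRung_of_rungOne`, `OddX.oddSpecialRung_of_rungOne`,
`OddX.oddSpecialRung_iff_rungOne`, `OddX.closes`, `OddX.oddGenericRung_of_ports`, `OddX.closes_of_engines`,
`OddX.deepSpecialRung_iff_oddSpecialRung`, `OddX.crossSpecialRung_iff_oddSpecialRung`,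
`OddX.spreadSpecialRung_iff_oddSpecialRung`, `OddX.cylSpecialRung_iff_oddSpecialRung`,
`OddX.splitSpecialRung_iff_oddSpecialRung`, `OddX.grandSpecialRung_iff_oddSpecialRung`,
`OddX.vastSpecialRung_iff_oddSpecialRung`, `OddX.leafSpecialRung_iff_oddSpecialRung`,
`OddX.leafGenericRung_of_oddGenericRung`, `OddX.pinchSpecialRung_iff_oddSpecialRung`,
`OddX.closes_of_deepSpecialRung`, `OddX.deep_closes_of_odd`.

(Sources: Hironaka1964 Ch. III; CossartJannsenSaito2020 Ch. 2, Ch. 8–9; CossartPiltant2008 Prop. 4.2;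
CossartPiltant2019 Rem. 3.2; BierstoneGrigorievMilmanWlodarczyk2011 §3.1; Moh1987; Hauser2010Kangaroo; Giraud1975;
Narasimhan1983.)
-/

open CategoryTheory AlgebraicGeometry TopologicalSpace IsLocalRing
open Literature.AlgebraicGeometry.Resolution
open Summit.ResolutionOfSingularities.ResolutionOfSingularities.Theorems
open Summit.ResolutionOfSingularities.ResolutionOfSingularities.Theorems.WeakOrderReduction
open Summit.ResolutionOfSingularities.ResolutionOfSingularities.Theorems.DeltaFaceCutClasses
open Summit.ResolutionOfSingularities.ResolutionOfSingularities.Theorems.RelativeDeltaCut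
open Summit.ResolutionOfSingularities.ResolutionOfSingularities.Theorems.CurveLeafExit
open Summit.ResolutionOfSingularities.ResolutionOfSingularities.Theorems.DeepCrossCut
open Summit.ResolutionOfSingularities.ResolutionOfSingularities.Theorems.PinchCut
open Summit.ResolutionOfSingularities.ResolutionOfSingularities.Theorems.JetCut
open Summit.ResolutionOfSingularities.ResolutionOfSingularities.Theorems.PurityCut
open Summit.ResolutionOfSingularities.ResolutionOfSingularities.Theorems.SplitCut
open Summit.ResolutionOfSingularities.ResolutionOfSingularities.Theorems.CylinderCut
open Summit.ResolutionOfSingularities.ResolutionOfSingularities.Theorems.SpreadCut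
open Summit.ResolutionOfSingularities.ResolutionOfSingularities.Theorems.CrossCut
open Summit.ResolutionOfSingularities.ResolutionOfSingularities.Theorems.DeepCrossCut
open MvPolynomial
open Summit.ResolutionOfSingularities.ResolutionOfSingularities.Theses

namespace Summit.ResolutionOfSingularities.ResolutionOfSingularities.Theorems.OddCrossCut

namespace OddX

section Kernels

variable {n : ℕ}

/-- **EXACT AT THE RUNG** (the ONE equivalence layer of this node): `RungOne ⟺ OddGenericRung ∧ OddSpecialRung`. [folklore] -/
theorem rungOne_iff : MaxContactCut.RungOne ↔ OddGenericRung ∧ OddSpecialRung :=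
  Leaf.rungOne_iff (L := oddLeaf)

/-- NECESSITY by letter. [folklore] -/
theorem oddGenericRung_of_rungOne (h : MaxContactCut.RungOne) : OddGenericRung := (rungOne_iff.mp h).1

/-- NECESSITY by letter. [folklore] -/
theorem oddSpecialRung_of_rungOne (h : MaxContactCut.RungOne) : OddSpecialRung := (rungOne_iff.mp h).2

/-- HONESTY KERNEL: modulo the decided half, the located residual IS the rung (cofinal). [folklore] -/
theorem oddSpecialRung_iff_rungOne (hG : OddGenericRung) : OddSpecialRung ↔ MaxContactCut.RungOne :=
  Leaf.specialRung_iff_rungOne (L := oddLeaf) hG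

/-- **DECIDING IMPLICATION OF THE NODE**: `MaxContactCut.RungOne` (29273) BY NAME from the two halves. [folklore] -/
theorem closes (hG : OddGenericRung) (hS : OddSpecialRung) : MaxContactCut.RungOne :=
  Leaf.closes (L := oddLeaf) hG hS

/-- **`OddGenericRung` with the cylinder engine DISCHARGED by the ports** (X1 via the TREE aside 30081
`MaxContactCut.MaxOrderThreefoldResolution` BY NAME). [folklore] -/
theorem oddGenericRung_of_ports (hV : VeryNearCutClasses.VeryNearExit) (hD : DeltaPackageExit)
    (hU : UniformCurvePackageExit) (hR : RelCurvePackageExit) (hN : NormalConeJumpExit)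
    (hM : MonomialPinchExit) (hC : FlatConeExit) (hGE : GrandExit) (hSE : SplitConeExit)
    (hJE : JetCylinderExit) (hX : MaxContactCut.MaxOrderThreefoldResolution) (hΓE : SpreadExit) (hXE : CrossExit)
    (hDXE : DeepCrossExit) (hNE : NodeExit) (hOXE : OddCrossExit)
    (hP : ∀ n : ℕ, 2 ≤ n → ComponentPackagePort n) (h1 : FaceFormCutClasses.OrderOneContact) : OddGenericRung :=
  oddGenericRung_of_engines hV hD hU hR hN hM hC hGE hSE (cylinderExit_of_ports hJE hX) hJE hΓE hXE hDXE hNE hOXE hP h1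

/-- `RungOne` BY NAME from the engines, the ports and the located residual. [folklore] -/
theorem closes_of_engines (hV : VeryNearCutClasses.VeryNearExit) (hD : DeltaPackageExit)
    (hU : UniformCurvePackageExit) (hR : RelCurvePackageExit) (hN : NormalConeJumpExit)
    (hM : MonomialPinchExit) (hC : FlatConeExit) (hGE : GrandExit) (hSE : SplitConeExit)
    (hJE : JetCylinderExit) (hX : MaxContactCut.MaxOrderThreefoldResolution) (hΓE : SpreadExit) (hXE : CrossExit)
    (hDXE : DeepCrossExit) (hNE : NodeExit) (hOXE : OddCrossExit)
    (hP : ∀ n : ℕ, 2 ≤ n → ComponentPackagePort n) (h1 : FaceFormCutClasses.OrderOneContact)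
    (hS : OddSpecialRung) : MaxContactCut.RungOne :=
  closes (oddGenericRung_of_ports hV hD hU hR hN hM hC hGE hSE hJE hX hΓE hXE hDXE hNE hOXE hP h1) hS

/-- **EXACT RE-LOCATION OF g22's `Deep.DeepSpecialRung`** (the located residual the instruction names): modulo the
odd decided half,
`Deep.DeepSpecialRung ⟺ OddSpecialRung`. [folklore] -/
theorem deepSpecialRung_iff_oddSpecialRung (hG : OddGenericRung) : Deep.DeepSpecialRung ↔ OddSpecialRung :=
  Deep.deepSpecialRung_iff.trans (Leaf.specialRung_iff_of_le deepLeaf_le_oddLeaf hG)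

/-- **EXACT RE-LOCATION OF g20's `Cross.CrossSpecialRung`**: modulo the odd decided half, `Cross.CrossSpecialRung ⟺
OddSpecialRung`.
[folklore] -/
theorem crossSpecialRung_iff_oddSpecialRung (hG : OddGenericRung) : Cross.CrossSpecialRung ↔ OddSpecialRung :=
  Cross.crossSpecialRung_iff.trans (Leaf.specialRung_iff_of_le crossLeaf_le_oddLeaf hG)

/-- **EXACT RE-LOCATION OF g19's `Spread.SpreadSpecialRung`**: modulo the odd decided half,
`Spread.SpreadSpecialRung ⟺ OddSpecialRung`.
[folklore] -/
theorem spreadSpecialRung_iff_oddSpecialRung (hG : OddGenericRung) : Spread.SpreadSpecialRung ↔ OddSpecialRung :=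
  Spread.spreadSpecialRung_iff.trans (Leaf.specialRung_iff_of_le spreadLeaf_le_oddLeaf hG)

/-- **EXACT RE-LOCATION OF g18's `Cyl.CylSpecialRung`**: modulo the odd decided half, `Cyl.CylSpecialRung ⟺
OddSpecialRung`. [folklore] -/
theorem cylSpecialRung_iff_oddSpecialRung (hG : OddGenericRung) : Cyl.CylSpecialRung ↔ OddSpecialRung :=
  Cyl.cylSpecialRung_iff.trans (Leaf.specialRung_iff_of_le cylLeaf_le_oddLeaf hG)

/-- **EXACT RE-LOCATION OF g17's `Split.SplitSpecialRung`**: modulo the odd decided half, `Split.SplitSpecialRung ⟺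
OddSpecialRung`.
[folklore] -/
theorem splitSpecialRung_iff_oddSpecialRung (hG : OddGenericRung) : Split.SplitSpecialRung ↔ OddSpecialRung :=
  Split.splitSpecialRung_iff.trans (Leaf.specialRung_iff_of_le splitLeaf_le_oddLeaf hG)

/-- **EXACT RE-LOCATION OF g16's `Grand.GrandSpecialRung`**: modulo the odd decided half, `Grand.GrandSpecialRung ⟺
OddSpecialRung`.
[folklore] -/
theorem grandSpecialRung_iff_oddSpecialRung (hG : OddGenericRung) : Grand.GrandSpecialRung ↔ OddSpecialRung :=
  Grand.grandSpecialRung_iff.trans (Leaf.specialRung_iff_of_le grandLeaf_le_oddLeaf hG)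

/-- **EXACT RE-LOCATION OF g15's `Vast.VastSpecialRung`**: modulo the odd decided half, `Vast.VastSpecialRung ⟺
OddSpecialRung`. [folklore] -/
theorem vastSpecialRung_iff_oddSpecialRung (hG : OddGenericRung) : Vast.VastSpecialRung ↔ OddSpecialRung :=
  vastSpecialRung_iff.trans (Leaf.specialRung_iff_of_le vastLeaf_le_oddLeaf hG)

/-- **EXACT RE-LOCATION OF THE TREE ASIDE 33866** `MaxContactCut.LeafSpecialRung` BY NAME: modulo the odd decided half,
`LeafSpecialRung ⟺ OddSpecialRung`. [folklore] -/
theorem leafSpecialRung_iff_oddSpecialRung (hG : OddGenericRung) : MaxContactCut.LeafSpecialRung ↔ OddSpecialRung :=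
  Leaf.leafSpecialRung_iff_specialRung (L := oddLeaf) hG

/-- The tree aside 33865 `MaxContactCut.LeafGenericRung` BY NAME from the odd decided half. [folklore] -/
theorem leafGenericRung_of_oddGenericRung (hG : OddGenericRung) : MaxContactCut.LeafGenericRung :=
  Leaf.leafGenericRung_of_genericRung (L := oddLeaf) hG

/-- **EXACT RE-LOCATION OF g14's `PinchSpecialRung`**: modulo the odd decided half, `PinchSpecialRung ⟺
OddSpecialRung`. [folklore] -/
theorem pinchSpecialRung_iff_oddSpecialRung (hG : OddGenericRung) : PinchSpecialRung ↔ OddSpecialRung :=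
  pinchSpecialRung_iff.trans (Leaf.specialRung_iff_of_le pinchLeaf_le_oddLeaf hG)

/-- `RungOne` BY NAME from the odd decided half and g22's residual (the old residual still closes). [folklore] -/
theorem closes_of_deepSpecialRung (hG : OddGenericRung) (hS : Deep.DeepSpecialRung) : MaxContactCut.RungOne :=
  closes hG (oddSpecialRung_of_deepSpecialRung hS)

/-- The g22 node's `Deep.closes` is RECOVERED from the odd halves plus engine-free monotonicity (nothing of g22 is
lost). [folklore] -/
theorem deep_closes_of_odd (hG : OddGenericRung) (hS : OddSpecialRung) : MaxContactCut.RungOne :=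
  Deep.closes (deepGenericRung_of_oddGenericRung hG) ((deepSpecialRung_iff_oddSpecialRung hG).mpr hS)

end Kernels

end OddX

end Summit.ResolutionOfSingularities.ResolutionOfSingularities.Theorems.OddCrossCut
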